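import Summits.BirchSwinnertonDyer.Rank1Residual.X11b.QuadraticTorsionOfRam
import Mathlib.GroupTheory.IndexNormal
import HarnessLib

/-!
# X11b, routes p2/R1 — `E[p]` irreducible, `p ≠ 2` ⟹ `E(K)[p] = 0` for every quadratic field `K`
# (no (ram) hypothesis; cell `b2b-bsdres`, sub-cell `multr1-p2`, gen 17)

HONEST FRAMING (cell `b2b-bsdres`, run/shared/lean/b2b/bsd-rank1-residual/, verbatim in every
file): the goal of the cell is to DELETE the COMBINATION-SHAPED residual classes of the
Birch–Swinnerton-Dyer formula for ALL analytic-rank `≤ 1` elliptic curves over `ℚ` — "full BSD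
formula for every rank `≤ 1` curve in class `C`" assembled STRICTLY from published theorems — so
that the rank-`≤ 1` remainder becomes exactly the CONSTRUCTION-SHAPED classes, which are TYPED
(missing-input `Prop`s), NOT attempted. This is not "finishing BSD". Sub-cell
`b2b-bsdres-multr1-p2` (X11b, route p2); a RESEARCH ROUTE; no claim beyond the stated class; X11b
stays CONSTRUCTION-SHAPED; nothing here changes a label; no named fact (theorems only; no `sorry`).

## Content

Gen 6's `torsion_eq_zero_of_irr_of_ram` proves `E(K)[p] = 0` over a quadratic `K` from `Irr ∧ Ram`
(absolute irreducibility of `ρ̄|_{Γ_K}` via a transvection). The (ram) hypothesis is not needed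
for the weaker conclusion "no `Γ_K`-FIXED vector" (Clifford): if `0 ≠ v ∈ E[p]` is fixed by the
index-two subgroup `N = Γ_K`, pick `a ∉ N`; then `w = ρ̄(a)v` is `N`-fixed too (`N` is normal),
`ρ̄(a)w = ρ̄(a²)v = v` (`a² ∈ N`), so `v + w` is fixed by ALL of `Γ_ℚ = N ∪ Na`; either `v + w ≠ 0`
spans a `Γ_ℚ`-stable line, or `w = −v` and `v` does — contradicting irreducibility (`p` arbitrary
here; oddness is not even used).

* `FramedRep.exists_stable_line_of_fixed_of_index_two` — the linear-algebra/group step for a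
  framed representation `ρ : G →ₜ* GL₂(k)` and an index-two subgroup.
* **`torsion_eq_zero_of_irr`** — for `W/ℚ` elliptic and globally minimal, `p` prime with `Irr W p`,
  `K ⊇ ℚ` with `[K:ℚ] = 2`, and `P ∈ E(K)` with `p • P = O`: `P = O`.

Role: the side condition "`E(K)[p] = 0`" of the Selmer count (`[E(K) : p^k E(K)] = p^k`,
`ord_p [E(K) : ℤP] = ord_p |c(P)|`) at the Heegner field on ALL of X11b (`Irr` is in the class
predicate), replacing its derivation from (iv) `E(ℚ_p)[p] = 0` (gen 16) or from (ram) (gen 6).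

References: [Serre1972] §2.8; [SilvermanAEC2009] III.§7, VIII.§1; [Castella2018Erratum] Lemma 2.1
footnote 1 (p. 4) ("irreducible").
-/

noncomputable section

open scoped Classical Matrix

namespace Summit.BirchSwinnertonDyer.Rank1Residual.X11b.Transvection

open WeierstrassCurve Field Literature.NumberTheory.EllipticCurves
  Literature.NumberTheory.GaloisRepresentations Literature.NumberTheory.EllipticCurves.Rank1Residual

/-! ### A vector fixed by an index-two subgroup gives a stable line -/

/-- **Clifford for index two, fixed vectors.** Let `ρ : G →ₜ* GL_n(k)` be a framed representation,
`N ≤ G` a subgroup of index `2`, and `v ≠ 0` a vector fixed by `ρ(N)`. Then some non-zero vector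
spans a `ρ(G)`-stable line (`v + ρ(a)v` for `a ∉ N`, or `v` itself if that sum vanishes); in
particular `ρ` is not irreducible when `n = 2`. [cite: Serre1972, §2.8 (stable lines and reducibility)] -/
theorem FramedRep.exists_stable_line_of_fixed_of_index_two {G : Type*} [Group G]
    [TopologicalSpace G] {k : Type*} [Field k] [TopologicalSpace k] {n : ℕ}
    (ρ : FramedRep G k n) {N : Subgroup G} (hN : N.index = 2) {v : Fin n → k} (hv0 : v ≠ 0)
    (hv : ∀ g ∈ N, ((ρ g : GL (Fin n) k) : Matrix (Fin n) (Fin n) k) *ᵥ v = v) :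
    ∃ x : Fin n → k, x ≠ 0 ∧ ∀ g : G,
      ((ρ g : GL (Fin n) k) : Matrix (Fin n) (Fin n) k) *ᵥ x ∈ Submodule.span k {x} := by
  -- notation: the matrix action
  let M : G → Matrix (Fin n) (Fin n) k := fun g ↦ ((ρ g : GL (Fin n) k) : Matrix (Fin n) (Fin n) k)
  have hMmul : ∀ g h : G, M (g * h) = M g * M h := fun g h ↦ by
    simp only [M, map_mul, Units.val_mul]
  have hM1 : M 1 = 1 := by simp only [M, map_one, Units.val_one]
  have hact : ∀ (g h : G) (y : Fin n → k), M (g * h) *ᵥ y = M g *ᵥ (M h *ᵥ y) := fun g h y ↦ by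
    rw [hMmul, Matrix.mulVec_mulVec]
  -- an element `a ∉ N`; `a² ∈ N`, `a⁻¹ n a ∈ N`, and `g a⁻¹ ∈ N` for `g ∉ N`
  obtain ⟨a, haN, -⟩ := (Subgroup.index_eq_two_iff_exists_notMem_and).mp hN
  have hmul := fun {x y : G} ↦ Subgroup.mul_mem_iff_of_index_two hN (a := x) (b := y)
  have ha2 : a * a ∈ N := hmul.mpr (by simp)
  have hainv : a⁻¹ ∉ N := fun h ↦ haN (by simpa using N.inv_mem h)
  have hconj : ∀ g ∈ N, a⁻¹ * g * a ∈ N := fun g hg ↦ by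
    refine hmul.mpr ⟨fun h ↦ absurd h ?_, fun h ↦ absurd h haN⟩
    exact fun h' ↦ hainv ((hmul.mp h').mpr hg)
  have hsplit : ∀ g : G, g ∉ N → g * a⁻¹ ∈ N := fun g hg ↦
    hmul.mpr ⟨fun h ↦ absurd h hg, fun h ↦ absurd h hainv⟩
  -- `w = ρ(a) v` is `N`-fixed and `ρ(a) w = v`
  set w := M a *ᵥ v with hw
  have hwN : ∀ g ∈ N, M g *ᵥ w = w := fun g hg ↦ by
    have h1 : g = a * (a⁻¹ * g * a) * a⁻¹ := by group
    rw [hw, ← hact, h1, mul_assoc, mul_assoc, inv_mul_cancel, mul_one, hact, hv _ (hconj g hg)]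
  have haw : M a *ᵥ w = v := by rw [hw, ← hact, hv _ ha2]
  -- the action of an arbitrary `g` on `v` and `w`
  have hgv : ∀ g : G, g ∉ N → M g *ᵥ v = w := fun g hg ↦ by
    have h1 : g = (g * a⁻¹) * a := by group
    rw [h1, hact, ← hw, hwN _ (hsplit g hg)]
  have hgw : ∀ g : G, g ∉ N → M g *ᵥ w = v := fun g hg ↦ by
    have h1 : g = (g * a⁻¹) * a := by group
    rw [h1, hact, haw, hv _ (hsplit g hg)]
  by_cases hsum : v + w = 0
  · -- `w = -v`: the line `k v` is stable
    have hwv : w = -v := eq_neg_of_add_eq_zero_right hsum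
    refine ⟨v, hv0, fun g ↦ ?_⟩
    by_cases hg : g ∈ N
    · rw [hv g hg]; exact Submodule.mem_span_singleton_self v
    · rw [hgv g hg, hwv]
      exact Submodule.neg_mem _ (Submodule.mem_span_singleton_self v)
  · -- `v + w ≠ 0` is fixed by everything
    refine ⟨v + w, hsum, fun g ↦ ?_⟩
    have hfix : M g *ᵥ (v + w) = v + w := by
      rw [Matrix.mulVec_add]
      by_cases hg : g ∈ N
      · rw [hv g hg, hwN g hg]
      · rw [hgv g hg, hgw g hg, add_comm]
    rw [hfix]; exact Submodule.mem_span_singleton_self _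

variable (W : WeierstrassCurve ℚ) [W.IsElliptic] (p : ℕ) [Fact p.Prime]

/-- **`E[p]` irreducible ⟹ `E(K)[p] = 0` for every quadratic field `K` (no (ram) hypothesis).** For
`W/ℚ` elliptic and globally minimal, a prime `p` with `E[p]` irreducible (`Irr W p`), a field
`K ⊇ ℚ` with `[K:ℚ] = 2`, and a `K`-rational point `P` with `p • P = O`: `P = O`. Proof: the image
of `P` in `E(ℚ̄)[p]` is fixed by the index-two subgroup `Γ_K` (`exists_fixed_geomTorsion_of_point`,
`isOpen_range_absGaloisRestrict_and_index`); a non-zero `Γ_K`-fixed vector yields a `Γ_ℚ`-stable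
line (`FramedRep.exists_stable_line_of_fixed_of_index_two`), contradicting irreducibility of the
frame `ρ̄` (`BCDT.isIrreducible_of_hasIrreducibleModPGaloisRep`).
[cite: Serre1972, §2.8] [cite: SilvermanAEC2009, VIII.§1 (Galois action on points)] -/
theorem torsion_eq_zero_of_irr (hirr : Irr W p)
    (K : Type) [Field K] [NumberField K] (hK : Module.finrank ℚ K = 2)
    (P : (W.baseChange K).toAffine.Point) (hP : (p : ℤ) • P = 0) : P = 0 := by
  by_contra hP0
  have hp : p.Prime := Fact.out
  haveI : NeZero ((p : ℕ) : ℚ) := ⟨by exact_mod_cast hp.ne_zero⟩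
  obtain ⟨ρ, hρ⟩ := W.exists_isTorsionGaloisRep p
  have hirrρ : FramedRep.IsIrreducible ρ :=
    Literature.NumberTheory.Automorphic.BCDT.isIrreducible_of_hasIrreducibleModPGaloisRep hirr hρ
  obtain ⟨e, he⟩ := hρ
  obtain ⟨Q, hQ0, hfix⟩ := exists_fixed_geomTorsion_of_point W K P hP hP0
  -- the frame vector of `Q` is fixed by `ρ̄(Γ_K)`, an index-two subgroup
  set v : Fin 2 → ZMod p := e Q with hv
  have hv0 : v ≠ 0 := by
    intro h
    apply hQ0
    apply e.injective
    rw [← hv, h, map_zero]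
  have hindex : (absGaloisRestrict ℚ K).toMonoidHom.range.index = 2 := by
    have h := (Literature.NumberTheory.Automorphic.isOpen_range_absGaloisRestrict_and_index ℚ K).2
    rw [hK] at h
    exact h
  have hvfix : ∀ g ∈ (absGaloisRestrict ℚ K).toMonoidHom.range,
      ((ρ g : GL (Fin 2) (ZMod p)) : Matrix (Fin 2) (Fin 2) (ZMod p)) *ᵥ v = v := by
    intro g hg
    have hg' : g ∈ (absGaloisRestrict ℚ K).range := by
      obtain ⟨τ, rfl⟩ := hg; exact ⟨τ, rfl⟩
    rw [hv, ← he g Q, hfix g hg']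
  -- a stable line contradicts irreducibility
  obtain ⟨x, hx0, hx⟩ := FramedRep.exists_stable_line_of_fixed_of_index_two ρ hindex hv0 hvfix
  let π := FramedRep.toRepresentation ρ
  let L : Subrepresentation π :=
    ⟨Submodule.span (ZMod p) {x}, fun τ y hy => by
      obtain ⟨c, rfl⟩ := Submodule.mem_span_singleton.mp hy
      rw [map_smul]
      refine Submodule.smul_mem _ c ?_
      rw [FramedRep.toRepresentation_apply_apply]
      exact hx τ⟩
  haveI := hirrρ
  rcases IsSimpleOrder.eq_bot_or_eq_top L with h | h
  · have hbot : Submodule.span (ZMod p) ({x} : Set (Fin 2 → ZMod p)) = ⊥ :=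
      congrArg Subrepresentation.toSubmodule h
    exact hx0 (Submodule.span_singleton_eq_bot.mp hbot)
  · have htop : Submodule.span (ZMod p) ({x} : Set (Fin 2 → ZMod p)) = ⊤ :=
      congrArg Subrepresentation.toSubmodule h
    have h1 : Module.finrank (ZMod p) (Submodule.span (ZMod p) ({x} : Set (Fin 2 → ZMod p))) = 1 :=
      finrank_span_singleton hx0
    rw [htop, finrank_top, Module.finrank_fin_fun] at h1
    exact absurd h1 (by norm_num)

/-- `E(K)` has no `p`-torsion on all of X11b's hypothesis `Irr W p` (quadratic `K`): the form
consumed by the Selmer-count bookkeeping, `∀ P, p • P = 0 → P = 0` with `p : ℕ`.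
[cite: Castella2018Erratum, Lemma 2.1 footnote 1 (p. 4)] -/
theorem forall_torsion_eq_zero_of_irr (hirr : Irr W p)
    (K : Type) [Field K] [NumberField K] (hK : Module.finrank ℚ K = 2) :
    ∀ P : (W.baseChange K).toAffine.Point, p • P = 0 → P = 0 := fun P hP ↦
  torsion_eq_zero_of_irr W p hirr K hK P (by rw [natCast_zsmul]; exact hP)

end Summit.BirchSwinnertonDyer.Rank1Residual.X11b.Transvection

end
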